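import Summits.Langlands.Langlands.Theorems.PicardMuOrdinaryMuOrdinaryFamilyRTThornePointAbsIrrRestrict
import Summits.Langlands.Langlands.Theorems.PicardMuOrdinaryMuOrdinaryFamilyRTThorneRbarAdequateUncond
import Summits.Langlands.Langlands.Theorems.PicardMuOrdinaryMuOrdinaryFamilyRTThorneAdequateBaseChange
import Literature.RingTheory.Valuation.AlgClosedResidue
import HarnessLib

/-!
# Crux `MuOrdinaryFamilyRT` (stmt-Langlands-13757), line `thorne-minimal-lift`:
# leaf P2 — hypothesis (ii) of Thorne's Thm 5.1 for the point representations `ρ_y|Γ_L` (PROVED)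

Leaf P2 of wave 4 (glue for `stub_pointAutomorphic`).  Thorne's minimal automorphy lifting theorem (tree named fact
`Thorne2017.automorphyLifting_unitary_ordinaryMinimal`, Math. Z. 285 (2017) Thm 5.1) is applied over auxiliary
fields `L ⊇ K = ℚ(ζ₃)` to `ρ = ρ_y|Γ_L`, `ρ_y = y ∘ 𝓕.ρ` the point representation (`pointRep 𝓕 y`) of a family
`𝓕 : OrdFamily f ι e S₀ ρ_C` at an integral `ℚ̄₃`-point `y`.  Its hypothesis (ii) consists of

  `ρ.IsResidualRepOf (RingHom.id _) τ`  and  `Subgroup.IsThorne2017Adequate ((absGaloisGroupAdjoinRootsOfUnity L 3).map τ)`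

for some `τ : Γ_L →* GL₃(ℤ̄₃/𝔪)`.  This file proves both for THE NATURAL `τ`: the residual heart pushed into the
residue field of `ℚ̄₃` and restricted to `Γ_L`,

  `τ_L = GL₃(φ) ∘ r̄_f^B ∘ res_K^L`,  `φ : 𝔽₃ → ℤ̄₃/𝔪` any ring homomorphism

(there is exactly one, Mathlib `ZMod.castHom`; the statements quantify over `φ` so that they apply verbatim to
whichever name the consumer uses — `algebraMap` under a local instance, `ZMod.castHom`, `zmodToPadicAlgClResidueField`),
under the standing hypothesis of the line that the heart KEEPS ITS IMAGE on `Γ_L`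
(`(r̄ ∘ res_K^L)(Γ_L) = r̄(Γ_K)`; supplied for the quadratic `F' = K(√d)` by `range_rbar_comp_absGaloisRestrict` and
along towers by …ThornePointAbsIrrRestrict § 4):

* § 1 `absGaloisGroupAdjoinRootsOfUnity_eq_top` — `Γ_{L(ζ_m)} = Γ_L` as soon as `L` contains a primitive `m`-th
  root of unity (the `m`-th roots of unity of `L̄` are its powers, which `Γ_L` fixes); in particular for every
  `K`-algebra `L` and `m = 3` (`ζ₃ ∈ K`, `FreeSeedSmoothRt.isPrimitiveRoot_zetaK`).  Hence the subgroup in (ii) is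
  the full image `τ_L(Γ_L) = GL₃(φ)(r̄(Γ_K))`.
* § 2 (b1) `isThorne2017Adequate_residual_pointRep` (registered) — that image is adequate in the sense of Thorne's
  Def. 2.20: `r̄(Γ_K) ≤ GL₃(𝔽₃)` is adequate in the extended sense (`rbarExtendedAdequate`, unconditional, for
  generic `f` with `disc f ∉ ℚ² ∪ −3ℚ²`), extended adequacy passes to `GL₃(φ)(r̄(Γ_K)) ≤ GL₃(ℤ̄₃/𝔪)`
  (`isExtendedAdequate_baseChange`, …ThorneAdequateBaseChange), and over the algebraically closed field `ℤ̄₃/𝔪`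
  (`Literature.RingTheory.Valuation.isAlgClosed_residueField`) the extended and the printed notions agree
  (`Subgroup.isThorne2017Adequate_iff_isExtendedAdequate`).
* § 3 the integral model of `ρ_y|Γ_L` in the identity frame: `ρ₀ = GL₃(y) ∘ 𝓕.ρ ∘ res_K^L` with `y` read in
  `ℤ̄₃ = {‖x‖ ≤ 1}` (`‖y r‖ ≤ 1`), and its reduction: `y` is LOCAL (`ℤ̄₃`-points of local rings over `ℤ₃` are,
  `padicAlgClInt_map_mem_maximalIdeal`), `ker π = 𝔪_R`, and `r ≡ (π r)^ℕ mod ker π`, so `y mod 𝔪 = φ ∘ π`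
  (`residue_pointCodRestrict`); with `𝓕.residual` (`𝓕.ρ mod π = r̄`) the reduction of `ρ₀` is `τ_L` on the nose
  (`isReductionOf_pointRep_restrictField`).
* § 4 (b2) `isResidualRepOf_pointRep_restrictField` (registered) — `τ_L` is a residual representation of
  `ρ_y|Γ_L` (`IsResidualRepOf` = semisimplification of a reduction): the reduction `τ_L` is irreducible, indeed
  absolutely irreducible (`isAbsIrreducible_rbar_comp_absGaloisRestrict` of …ThornePointAbsIrrRestrict, from
  `FreeSeedSmoothRt.rbarAbsIrreducible` and the kept image), so it is its own semisimplification
  (`IsReductionOf.isResidualRepOf_of_isIrreducible`).  Continuity of `y` is not needed (only integrality).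

No definition, no named fact.
-/

set_option linter.dupNamespace false -- `Summit.Langlands.Langlands.…` is the problem's namespace

namespace Summit.Langlands.Langlands.Cruxes.MuOrdinaryFamilyRT.ThorneMinimalLift

open scoped NumberField Polynomial Matrix Classical
open Field IsDedekindDomain Polynomial IsLocalRing
open Literature.NumberTheory.GaloisRepresentations Literature.NumberTheory.Automorphic
open Summit.Langlands.Langlands.Cruxes.MuOrdinaryFamilyRT.CharZeroDominance

noncomputable section

variable {f : ℤ[X]} {ι : PadicAlgCl 3 ≃+* ℂ} {e : K →+* ℂ} {S₀ : Finset (HeightOneSpectrum (𝓞 K))}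
  {ρC : FramedGaloisRep K (PadicAlgCl 3) 3}

/-! ## 1. `Γ_{L(ζ_m)} = Γ_L` when `ζ_m ∈ L` -/

/-- **`Γ_{L(ζ_m)} = Γ_L` if `L` contains a primitive `m`-th root of unity `ζ`**: the `m`-th roots of unity of `L̄`
are the powers of the image of `ζ`, which every `σ ∈ Γ_L` fixes. -/
theorem absGaloisGroupAdjoinRootsOfUnity_eq_top {L : Type*} [Field L] {m : ℕ} [NeZero m] {ζ : L}
    (hζ : IsPrimitiveRoot ζ m) : absGaloisGroupAdjoinRootsOfUnity L m = ⊤ := by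
  rw [eq_top_iff]
  intro σ _
  rw [mem_absGaloisGroupAdjoinRootsOfUnity_iff]
  intro x hx
  have hζ' : IsPrimitiveRoot (algebraMap L (AlgebraicClosure L) ζ) m :=
    hζ.map_of_injective (algebraMap L (AlgebraicClosure L)).injective
  obtain ⟨i, -, rfl⟩ := hζ'.eq_pow_of_pow_eq_one hx
  rw [smul_pow', absoluteGaloisGroup.smul_def, AlgEquiv.commutes]

/-- **`Γ_{L(ζ₃)} = Γ_L` for every extension `L` of `K = ℚ(ζ₃)`** (`ζ₃ ∈ K ⊆ L`). -/
theorem absGaloisGroupAdjoinRootsOfUnity_three_eq_top (L : Type*) [Field L] [Algebra K L] :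
    absGaloisGroupAdjoinRootsOfUnity L 3 = ⊤ :=
  absGaloisGroupAdjoinRootsOfUnity_eq_top
    (FreeSeedSmoothRt.isPrimitiveRoot_zetaK.map_of_injective (algebraMap K L).injective)

/-- Hence the subgroup of hypothesis (ii) is the full image: `τ(Γ_{L(ζ₃)}) = τ(Γ_L)` for every `τ` on `Γ_L`. -/
theorem map_absGaloisGroupAdjoinRootsOfUnity_three_eq_range (L : Type*) [Field L] [Algebra K L]
    {G : Type*} [Group G] (τ : absoluteGaloisGroup L →* G) :
    (absGaloisGroupAdjoinRootsOfUnity L 3).map τ = τ.range := by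
  rw [absGaloisGroupAdjoinRootsOfUnity_three_eq_top L, ← MonoidHom.range_eq_map]

/-! ## 2. (b1) Adequacy of the residual image over `L` -/

/-- **The image of `τ_L = GL₃(φ) ∘ r̄ ∘ res_K^L` is adequate in the extended sense** whenever `L` keeps the image
of the heart: it is `GL₃(φ)(r̄(Γ_K))`, a finite group (a subgroup of `GL₃(𝔽₃)`), and extended adequacy of
`r̄(Γ_K)` (`rbarExtendedAdequate`) passes along `φ` (`isExtendedAdequate_baseChange`). -/
theorem isExtendedAdequate_range_rbar_residual (hgen : Generic f)
    (hD : ¬ IsSquare (f.map (Int.castRingHom ℚ)).discr)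
    (hD3 : ¬ IsSquare ((-3 : ℚ) * (f.map (Int.castRingHom ℚ)).discr))
    (B : Module.Basis (Fin 3) (ZMod 3) (Heart 3 (Roots f))) (L : Type*) [Field L] [Algebra K L]
    (hL : ((rbar f B).comp (absGaloisRestrict K L).toMonoidHom).range = (rbar f B).range)
    {k' : Type} [Field k'] (φ : ZMod 3 →+* k') :
    Subgroup.IsExtendedAdequate
      ((Matrix.GeneralLinearGroup.map φ).comp ((rbar f B).comp (absGaloisRestrict K L).toMonoidHom)).range := by
  rw [MonoidHom.range_comp, hL]
  exact isExtendedAdequate_baseChange φ _ (rbarExtendedAdequate f B hgen hD hD3)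

/-- **(b1) `isThorne2017Adequate_residual_pointRep` (registered leaf, PROVED).**  For generic `f` with
`disc f ∉ ℚ² ∪ −3ℚ²` (the `MainClass` clauses), a basis `B` of the heart, an extension `L` of `K = ℚ(ζ₃)` on which the
heart keeps its image, and any `φ : 𝔽₃ → ℤ̄₃/𝔪`, the subgroup `τ_L(Γ_{L(ζ₃)}) ≤ GL₃(ℤ̄₃/𝔪)`,
`τ_L = GL₃(φ) ∘ r̄_f^B ∘ res_K^L`, is adequate in the sense of Thorne, Math. Z. 285 (2017), Def. 2.20 — hypothesis
(ii), second half, of `Thorne2017.automorphyLifting_unitary_ordinaryMinimal` for `F = L`, `p = 3`, `τ = τ_L`: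
`Γ_{L(ζ₃)} = Γ_L` (§ 1), the image is `GL₃(φ)(r̄(Γ_K))`, extended-adequate by `rbarExtendedAdequate` +
`isExtendedAdequate_baseChange`, and `ℤ̄₃/𝔪` is algebraically closed so that Def. 2.20 ⟺ extended adequacy
(`Subgroup.isThorne2017Adequate_iff_isExtendedAdequate`). -/
theorem isThorne2017Adequate_residual_pointRep : ∀ (f : ℤ[X]) (B : Module.Basis (Fin 3) (ZMod 3) (Heart 3 (Roots f))), Generic f → ¬ IsSquare (f.map (Int.castRingHom ℚ)).discr → ¬ IsSquare ((-3 : ℚ) * (f.map (Int.castRingHom ℚ)).discr) → ∀ (L : Type) [Field L] [Algebra K L], ((rbar f B).comp (absGaloisRestrict K L).toMonoidHom).range = (rbar f B).range → ∀ (φ : ZMod 3 →+* padicAlgClResidueField 3), Subgroup.IsThorne2017Adequate ((absGaloisGroupAdjoinRootsOfUnity L 3).map ((Matrix.GeneralLinearGroup.map φ).comp ((rbar f B).comp (absGaloisRestrict K L).toMonoidHom))) := by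
  intro f B hgen hD hD3 L _ _ hL φ
  haveI : IsAlgClosed (padicAlgClResidueField 3) :=
    Literature.RingTheory.Valuation.isAlgClosed_residueField (padicAlgClIntegers 3)
  rw [map_absGaloisGroupAdjoinRootsOfUnity_three_eq_range, Subgroup.isThorne2017Adequate_iff_isExtendedAdequate]
  exact isExtendedAdequate_range_rbar_residual hgen hD hD3 B L hL φ

/-! ## 3. The integral model of `ρ_y|Γ_L` in the identity frame and its reduction -/

/-- Values of an integral point lie in `ℤ̄₃ = {‖x‖ ≤ 1}`. -/
theorem point_mem_padicAlgClIntegers (𝓕 : OrdFamily f ι e S₀ ρC) (y : 𝓕.R →+* PadicAlgCl 3)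
    (hy : ∀ r : 𝓕.R, ‖y r‖ ≤ 1) (r : 𝓕.R) : y r ∈ padicAlgClIntegers 3 :=
  (padicAlgCl_mem_valuationSubring_iff 3 _).2 (hy r)

/-- `ker π = 𝔪_R` (`π : R ↠ 𝔽₃`, `R` local). -/
theorem ker_pi_eq_maximalIdeal (𝓕 : OrdFamily f ι e S₀ ρC) :
    RingHom.ker (𝓕.π : 𝓕.R →+* ZMod 3) = maximalIdeal 𝓕.R :=
  IsLocalRing.eq_maximalIdeal (RingHom.ker_isMaximal_of_surjective 𝓕.π 𝓕.π_surjective)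

/-- Every `r ∈ R` is congruent modulo `𝔪_R` to the natural number `(π r)^ℕ ∈ {0, 1, 2}`. -/
theorem sub_natCast_val_mem_maximalIdeal (𝓕 : OrdFamily f ι e S₀ ρC) (r : 𝓕.R) :
    r - ((𝓕.π r).val : 𝓕.R) ∈ maximalIdeal 𝓕.R := by
  rw [← ker_pi_eq_maximalIdeal, RingHom.mem_ker, map_sub, map_natCast]
  change 𝓕.π r - ((𝓕.π r).val : ZMod 3) = 0
  rw [ZMod.natCast_zmod_val, sub_self]

/-- **The reduction of an integral point is `φ ∘ π`.**  An integral point `y : R → ℤ̄₃` (`y'` its corestriction)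
is a LOCAL homomorphism (`R` is local and receives `ℤ₃`: `padicAlgClInt_map_mem_maximalIdeal`), so
`y' r ≡ y' ((π r)^ℕ) = (π r)^ℕ mod 𝔪`, i.e. `y' r mod 𝔪 = φ (π r)` for the (unique) `φ : 𝔽₃ → ℤ̄₃/𝔪`. -/
theorem residue_pointCodRestrict (𝓕 : OrdFamily f ι e S₀ ρC) (y : 𝓕.R →+* PadicAlgCl 3)
    (hy : ∀ r : 𝓕.R, ‖y r‖ ≤ 1) (φ : ZMod 3 →+* padicAlgClResidueField 3) (r : 𝓕.R) :
    residue (padicAlgClIntegers 3) (y.codRestrict (padicAlgClIntegers 3) (point_mem_padicAlgClIntegers 𝓕 y hy) r) =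
      φ (𝓕.π r) := by
  set y' : 𝓕.R →+* padicAlgClIntegers 3 :=
    y.codRestrict (padicAlgClIntegers 3) (point_mem_padicAlgClIntegers 𝓕 y hy) with hy'
  have hloc : y' (r - ((𝓕.π r).val : 𝓕.R)) ∈ maximalIdeal (padicAlgClIntegers 3) :=
    padicAlgClInt_map_mem_maximalIdeal 3 ((algebraMap 𝓕.𝒪 𝓕.R).comp (algebraMap ℤ_[3] 𝓕.𝒪)) y'
      (sub_natCast_val_mem_maximalIdeal 𝓕 r)
  rw [← residue_eq_zero_iff, map_sub, map_sub, sub_eq_zero, map_natCast, map_natCast] at hloc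
  rw [hloc]
  conv_rhs => rw [← ZMod.natCast_zmod_val (𝓕.π r), map_natCast]

/-- **The integral model in the identity frame**: `ρ₀ = GL₃(y') ∘ 𝓕.ρ ∘ res_K^L` is an integral model (`P = 1`) of
`ρ_y|Γ_L` for every framing `ρy` of `pointRep 𝓕 y`. -/
theorem isIntegralModelOf_pointRep_restrictField (𝓕 : OrdFamily f ι e S₀ ρC) (y : 𝓕.R →+* PadicAlgCl 3)
    (hy : ∀ r : 𝓕.R, ‖y r‖ ≤ 1) (L : Type*) [Field L] [Algebra K L]
    (ρy : FramedGaloisRep K (PadicAlgCl 3) 3) (hρy : ∀ g, ρy g = pointRep 𝓕 y g) :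
    IsIntegralModelOf (ρy.restrictField L : absoluteGaloisGroup L →* GL (Fin 3) (PadicAlgCl 3))
      ((Matrix.GeneralLinearGroup.map (y.codRestrict (padicAlgClIntegers 3) (point_mem_padicAlgClIntegers 𝓕 y hy))).comp
        (𝓕.ρ.comp (absGaloisRestrict K L).toMonoidHom)) := by
  refine ⟨1, fun g => ?_⟩
  rw [inv_one, one_mul, mul_one]
  apply Units.ext
  change (((𝓕.ρ (absGaloisRestrict K L g)).val.map
      (y.codRestrict (padicAlgClIntegers 3) (point_mem_padicAlgClIntegers 𝓕 y hy))).map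
        (padicAlgClIntegers 3).subtype) = (ρy (absGaloisRestrict K L g)).val
  rw [hρy, Matrix.map_map]
  rfl

/-- **The reduction of the integral model is `τ_L` on the nose**: entrywise `y' ((𝓕.ρ σ)ᵢⱼ) mod 𝔪 = φ (π ((𝓕.ρ σ)ᵢⱼ))
= φ ((r̄ σ)ᵢⱼ)` (`residue_pointCodRestrict`, `𝓕.residual`). -/
theorem integralReduction_pointRep_restrictField (𝓕 : OrdFamily f ι e S₀ ρC) (y : 𝓕.R →+* PadicAlgCl 3)
    (hy : ∀ r : 𝓕.R, ‖y r‖ ≤ 1) (L : Type*) [Field L] [Algebra K L]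
    (φ : ZMod 3 →+* padicAlgClResidueField 3) (g : absoluteGaloisGroup L) :
    integralReduction (RingHom.id _)
        ((Matrix.GeneralLinearGroup.map (y.codRestrict (padicAlgClIntegers 3) (point_mem_padicAlgClIntegers 𝓕 y hy))).comp
          (𝓕.ρ.comp (absGaloisRestrict K L).toMonoidHom)) g =
      (Matrix.GeneralLinearGroup.map φ).comp ((rbar f 𝓕.B).comp (absGaloisRestrict K L).toMonoidHom) g := by
  apply Units.ext
  ext i j
  rw [integralReduction_apply_coe, RingHom.id_apply]
  change residue (padicAlgClIntegers 3)
      (y.codRestrict (padicAlgClIntegers 3) (point_mem_padicAlgClIntegers 𝓕 y hy)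
        ((𝓕.ρ (absGaloisRestrict K L g)).val i j)) =
    φ ((rbar f 𝓕.B (absGaloisRestrict K L g)).val i j)
  rw [residue_pointCodRestrict 𝓕 y hy φ, ← 𝓕.residual (absGaloisRestrict K L g), Matrix.map_apply]
  rfl

/-- **`τ_L` is a reduction of `ρ_y|Γ_L`** (`IsReductionOf` along `RingHom.id (ℤ̄₃/𝔪)`, frames `P = Q = 1`). -/
theorem isReductionOf_pointRep_restrictField (𝓕 : OrdFamily f ι e S₀ ρC) (y : 𝓕.R →+* PadicAlgCl 3)
    (hy : ∀ r : 𝓕.R, ‖y r‖ ≤ 1) (L : Type*) [Field L] [Algebra K L]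
    (ρy : FramedGaloisRep K (PadicAlgCl 3) 3) (hρy : ∀ g, ρy g = pointRep 𝓕 y g)
    (φ : ZMod 3 →+* padicAlgClResidueField 3) :
    (ρy.restrictField L).IsReductionOf (RingHom.id _)
      ((Matrix.GeneralLinearGroup.map φ).comp ((rbar f 𝓕.B).comp (absGaloisRestrict K L).toMonoidHom)) :=
  ⟨_, 1, isIntegralModelOf_pointRep_restrictField 𝓕 y hy L ρy hρy, fun g => by
    rw [one_mul, inv_one, mul_one, integralReduction_pointRep_restrictField 𝓕 y hy L φ g]⟩

/-! ## 4. (b2) `τ_L` is a residual representation of `ρ_y|Γ_L` -/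

/-- **`τ_L` is irreducible** when `L` keeps the image of the heart (`r̄ ∘ res_K^L` is absolutely irreducible,
`isAbsIrreducible_rbar_comp_absGaloisRestrict`, and `φ` is one of the allowed scalar extensions). -/
theorem isIrreducible_rbar_residual (hgen : Generic f) (B : Module.Basis (Fin 3) (ZMod 3) (Heart 3 (Roots f)))
    (L : Type*) [Field L] [Algebra K L]
    (hL : ((rbar f B).comp (absGaloisRestrict K L).toMonoidHom).range = (rbar f B).range)
    {k' : Type} [Field k'] (φ : ZMod 3 →+* k') :
    (glRepresentation ((Matrix.GeneralLinearGroup.map φ).comp ((rbar f B).comp (absGaloisRestrict K L).toMonoidHom))).IsIrreducible :=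
  isAbsIrreducible_rbar_comp_absGaloisRestrict hgen B L hL k' φ

/-- **(b2) `isResidualRepOf_pointRep_restrictField` (registered leaf, PROVED).**  For generic `f`, a family `𝓕`, an
extension `L` of `K` on which the heart keeps its image, an INTEGRAL `ℚ̄₃`-point `y` of `𝓕.R` (`‖y r‖ ≤ 1`; continuity
is not needed), any framing `ρy` of `pointRep 𝓕 y` and any `φ : 𝔽₃ → ℤ̄₃/𝔪`, the homomorphism
`τ_L = GL₃(φ) ∘ r̄_f^B ∘ res_K^L : Γ_L → GL₃(ℤ̄₃/𝔪)` (with `B = 𝓕.B`) is a residual representation of `ρ_y|Γ_L` along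
`RingHom.id (ℤ̄₃/𝔪)` — hypothesis (ii), first half, of `Thorne2017.automorphyLifting_unitary_ordinaryMinimal` for
`ρ = ρy.restrictField L`, `τ = τ_L`: `τ_L` is the reduction of the integral model `GL₃(y) ∘ 𝓕.ρ ∘ res_K^L` in the
identity frame (`isReductionOf_pointRep_restrictField`: `y` is local and `𝓕.ρ mod π = r̄`), and it is irreducible
(`isIrreducible_rbar_residual`), hence its own semisimplification (`IsReductionOf.isResidualRepOf_of_isIrreducible`). -/
theorem isResidualRepOf_pointRep_restrictField : ∀ (f : ℤ[X]) (ι : PadicAlgCl 3 ≃+* ℂ) (e : K →+* ℂ) (S₀ : Finset (HeightOneSpectrum (𝓞 K))) (ρC : FramedGaloisRep K (PadicAlgCl 3) 3) (𝓕 : OrdFamily f ι e S₀ ρC), Generic f → ∀ (L : Type) [Field L] [Algebra K L], ((rbar f 𝓕.B).comp (absGaloisRestrict K L).toMonoidHom).range = (rbar f 𝓕.B).range → ∀ (y : 𝓕.R →+* PadicAlgCl 3), (∀ r : 𝓕.R, ‖y r‖ ≤ 1) → ∀ ρy : FramedGaloisRep K (PadicAlgCl 3) 3, (∀ g, ρy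 g = pointRep 𝓕 y g) → ∀ (φ : ZMod 3 →+* padicAlgClResidueField 3), (ρy.restrictField L).IsResidualRepOf (RingHom.id _) ((Matrix.GeneralLinearGroup.map φ).comp ((rbar f 𝓕.B).comp (absGaloisRestrict K L).toMonoidHom)) := by
  intro f ι e S₀ ρC 𝓕 hgen L _ _ hL y hy ρy hρy φ
  exact (isReductionOf_pointRep_restrictField 𝓕 y hy L ρy hρy φ).isResidualRepOf_of_isIrreducible
    (isIrreducible_rbar_residual hgen 𝓕.B L hL φ)

/-- **Hypothesis (ii) of Thorne's Thm 5.1 for `ρ_y|Γ_L`, both halves at once** (the shape consumed by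
`stub_pointAutomorphic`): for generic `f` with `disc f ∉ ℚ² ∪ −3ℚ²`, a family `𝓕`, an image-keeping extension `L/K`, an
integral point `y`, a framing `ρy` of `pointRep 𝓕 y` and `φ : 𝔽₃ → ℤ̄₃/𝔪`, the natural `τ_L` is a residual representation
of `ρy.restrictField L` with `τ_L(Γ_{L(ζ₃)})` adequate in the sense of Def. 2.20. -/
theorem thorneHypothesisTwo_pointRep_restrictField (𝓕 : OrdFamily f ι e S₀ ρC) (hgen : Generic f)
    (hD : ¬ IsSquare (f.map (Int.castRingHom ℚ)).discr)
    (hD3 : ¬ IsSquare ((-3 : ℚ) * (f.map (Int.castRingHom ℚ)).discr))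
    (L : Type) [Field L] [Algebra K L]
    (hL : ((rbar f 𝓕.B).comp (absGaloisRestrict K L).toMonoidHom).range = (rbar f 𝓕.B).range)
    (y : 𝓕.R →+* PadicAlgCl 3) (hy : ∀ r : 𝓕.R, ‖y r‖ ≤ 1)
    (ρy : FramedGaloisRep K (PadicAlgCl 3) 3) (hρy : ∀ g, ρy g = pointRep 𝓕 y g)
    (φ : ZMod 3 →+* padicAlgClResidueField 3) :
    (ρy.restrictField L).IsResidualRepOf (RingHom.id _)
        ((Matrix.GeneralLinearGroup.map φ).comp ((rbar f 𝓕.B).comp (absGaloisRestrict K L).toMonoidHom)) ∧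
      Subgroup.IsThorne2017Adequate ((absGaloisGroupAdjoinRootsOfUnity L 3).map
        ((Matrix.GeneralLinearGroup.map φ).comp ((rbar f 𝓕.B).comp (absGaloisRestrict K L).toMonoidHom))) :=
  ⟨isResidualRepOf_pointRep_restrictField f ι e S₀ ρC 𝓕 hgen L hL y hy ρy hρy φ,
    isThorne2017Adequate_residual_pointRep f 𝓕.B hgen hD hD3 L hL φ⟩

end

end Summit.Langlands.Langlands.Cruxes.MuOrdinaryFamilyRT.ThorneMinimalLift
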